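import Summits.NavierStokesRegularity.NavierStokesRegularity.Theorems.EfficiencyFloorNearSaturationNearMaximiserSeqCoreHeatCompact
import HarnessLib

/-!
# Route `EfficiencyFloor`, crux `NearSaturationNearMaximiser` (stmt-NavierStokesRegularity-25482) on the
# `ProductionEfficiencyDecay` ladder (stmt-22866): LOCAL RELLICH ON `ℝ³` FROM TWO HEAT-SEMIGROUP FACTS

Def-free helper file, sixteenth of the group. Hypothesis (R) of `nearSaturationNearMaximiser_of_rellich_of_identification`
(`…SeqCoreRellichSplit`) — local `L²` compactness of `H¹(ℝ³)`-bounded sequences of `C¹` fields — is ASSEMBLED here from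
(1) sequential Banach–Alaoglu (`…SeqCoreWeakLimit`), (2) weak ⟹ local strong after heat mollification (`…SeqCoreHeatCompact`), and two
textbook properties of the heat semigroup kept as hypotheses:
 (HM) the MOLLIFICATION ESTIMATE `∫‖g − e^{tΔ}g‖² ≤ C_m · t · ∫‖Dg‖²` for `C¹` fields with `g, Dg ∈ L²`
      (`e^{tΔ}g − g = ∫₀ᵗ Δe^{sΔ}g`, `‖∇e^{sΔ}h‖₂ ≤ c s^{-1/2}‖h‖₂`; tree: `heatExtension_sub_eq_integral_laplacian`,
      `eLpNorm_fderiv_heatExtension_apply_le`, `fderiv_heatExtension_apply_eq_heatExtension_fderiv`);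
 (HC) the `L²`-CONTINUITY of the heat semigroup at `t = 0⁺`: `∫‖e^{tΔ}G − G‖² → 0` for `G ∈ L²`
      (density of `C_c^∞` + (HM) + the contraction `eLpNorm_heatExtension_le_holds`).
The `3ε`-assembly: `‖g_k − G‖² ≤ 3(‖g_k − e^{tΔ}g_k‖² + ‖e^{tΔ}g_k − e^{tΔ}G‖² + ‖e^{tΔ}G − G‖²)`.

* `norm_sub_sq_le_three` — the elementary three-term bound;
* `localRellich_of_heat` — (R) ⟸ (HM) ∧ (HC);
* `nearSaturationNearMaximiser_of_heat_of_identification` — BY NAME: stmt-25482 ⟸ (HM) ∧ (HC) ∧ (I).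

HONEST FRAMING: (HM), (HC) are standard but NOT yet proved in the tree; (I) is open; stmt-25482, `LerayFloorGap`,
`ProductionEfficiencyDecay` (stmt-22866) and Navier–Stokes regularity stay OPEN; no summit statement is proved. [folklore]
-/

-- the problem directory repeats the summit name (`NavierStokesRegularity/NavierStokesRegularity`)
set_option linter.dupNamespace false

noncomputable section

namespace Summit.NavierStokesRegularity.NavierStokesRegularity.Theorems

namespace NearSaturationNearMaximiser

namespace SeqCore

open Set MeasureTheory Filter Topology Function Real
open scoped InnerProductSpace ENNReal NNReal
open Literature.Analysis.UnboundedOperators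

/-- `‖a − d‖² ≤ 3 (‖a − b‖² + ‖b − c‖² + ‖c − d‖²)`. [folklore] -/
theorem norm_sub_sq_le_three {F : Type*} [NormedAddCommGroup F] (a b c d : F) :
    ‖a - d‖ ^ 2 ≤ 3 * (‖a - b‖ ^ 2 + ‖b - c‖ ^ 2 + ‖c - d‖ ^ 2) := by
  have h : ‖a - d‖ ≤ ‖a - b‖ + ‖b - c‖ + ‖c - d‖ := by
    calc ‖a - d‖ = ‖(a - b) + (b - c) + (c - d)‖ := by congr 1; abel
      _ ≤ ‖a - b‖ + ‖b - c‖ + ‖c - d‖ := norm_add₃_le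
  have h0 : 0 ≤ ‖a - d‖ := norm_nonneg _
  nlinarith [sq_nonneg (‖a - b‖ - ‖b - c‖), sq_nonneg (‖b - c‖ - ‖c - d‖), sq_nonneg (‖a - b‖ - ‖c - d‖),
    mul_self_le_mul_self h0 h, norm_nonneg (a - b), norm_nonneg (b - c), norm_nonneg (c - d)]

/-- `‖f‖² ∈ L¹` for `f ∈ L²`. [folklore] -/
theorem integrable_norm_sq_of_memLp_two {F : Type*} [NormedAddCommGroup F] {f : EuclideanSpace ℝ (Fin 3) → F}
    (hf : MemLp f 2 volume) : Integrable (fun x => ‖f x‖ ^ 2) :=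
  (memLp_two_iff_integrable_sq_norm hf.1).1 hf

/-- **Local Rellich–Kondrachov on `ℝ³` from the heat semigroup.** Assume (HM) the mollification estimate and (HC) the `L²`-continuity
of `e^{tΔ}` at `0⁺`. Then every sequence of `C¹` fields `g_k` with `∫‖g_k‖² ≤ 1`, `∫‖Dg_k‖² ≤ 1` has a subsequence converging in
`L²(B(0,R))`, for every `R`, to one `L²` field (its weak limit). [cite: Evans2010, §5.7 Thm. 1] -/
theorem localRellich_of_heat
    (HM : ∃ Cm : ℝ, ∀ g : EuclideanSpace ℝ (Fin 3) → EuclideanSpace ℝ (Fin 3), ContDiff ℝ 1 g →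
      Integrable (fun x => ‖g x‖ ^ 2) → Integrable (fun x => ‖fderiv ℝ g x‖ ^ 2) → ∀ t : ℝ, 0 < t →
        Integrable (fun x => ‖g x - heatExtension g t x‖ ^ 2) ∧
          ∫ x, ‖g x - heatExtension g t x‖ ^ 2 ≤ Cm * t * ∫ x, ‖fderiv ℝ g x‖ ^ 2)
    (HC : ∀ G : EuclideanSpace ℝ (Fin 3) → EuclideanSpace ℝ (Fin 3), MemLp G 2 volume →
      Tendsto (fun t : ℝ => ∫ x, ‖heatExtension G t x - G x‖ ^ 2) (𝓝[>] 0) (𝓝 0)) :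
    ∀ g : ℕ → EuclideanSpace ℝ (Fin 3) → EuclideanSpace ℝ (Fin 3), (∀ k, ContDiff ℝ 1 (g k)) →
      (∀ k, Integrable (fun x => ‖g k x‖ ^ 2)) → (∀ k, Integrable (fun x => ‖fderiv ℝ (g k) x‖ ^ 2)) →
      (∀ k, ∫ x, ‖g k x‖ ^ 2 ≤ 1) → (∀ k, ∫ x, ‖fderiv ℝ (g k) x‖ ^ 2 ≤ 1) →
      ∃ Ω : EuclideanSpace ℝ (Fin 3) → EuclideanSpace ℝ (Fin 3), MemLp Ω 2 volume ∧ ∃ φ : ℕ → ℕ, StrictMono φ ∧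
        ∀ R : ℝ, 0 < R → Tendsto (fun k => ∫ x in Metric.ball (0 : EuclideanSpace ℝ (Fin 3)) R, ‖g (φ k) x - Ω x‖ ^ 2)
          atTop (𝓝 0) := by
  intro g hg1 hI2 hID hZ hD
  obtain ⟨Cm, hM⟩ := HM
  have hg2 : ∀ k, MemLp (g k) 2 volume := fun k =>
    (memLp_two_iff_integrable_sq_norm (hg1 k).continuous.aestronglyMeasurable).2 (hI2 k)
  -- (1) the weak limit
  obtain ⟨G, hG, φ, hφ, hweak⟩ := exists_weakLimit_memLp_two hg2 (C := 1) hZ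
  refine ⟨G, hG, φ, hφ, fun R hR => ?_⟩
  rw [Metric.tendsto_atTop]
  intro ε hε
  -- choose the mollification time `t`
  have h1 : ∀ᶠ t in 𝓝[>] (0 : ℝ), ∫ x, ‖heatExtension G t x - G x‖ ^ 2 < ε / 9 :=
    (HC G hG).eventually_lt_const (by positivity)
  have h2 : ∀ᶠ t in 𝓝[>] (0 : ℝ), |Cm| * t < ε / 9 := by
    have hc : Tendsto (fun t : ℝ => |Cm| * t) (𝓝[>] 0) (𝓝 0) := by
      have h : Tendsto (fun t : ℝ => |Cm| * t) (𝓝 0) (𝓝 (|Cm| * 0)) := tendsto_const_nhds.mul tendsto_id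
      rw [mul_zero] at h
      exact h.mono_left nhdsWithin_le_nhds
    exact hc.eventually_lt_const (by positivity)
  have h3 : ∀ᶠ t in 𝓝[>] (0 : ℝ), 0 < t := eventually_mem_nhdsWithin
  obtain ⟨t, ht1, ht2, ht0⟩ := (h1.and (h2.and h3)).exists
  -- (2) the mollified sequence converges locally strongly
  have h4 := tendsto_setIntegral_heatExtension_sub_sq_of_weak (g := fun k => g (φ k)) (fun k => hg2 (φ k)) hG (C := 1)
    (fun k => hZ (φ k)) hweak ht0 R
  rw [Metric.tendsto_atTop] at h4
  obtain ⟨N, hN⟩ := h4 (ε / 9) (by positivity)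
  refine ⟨N, fun k hk => ?_⟩
  have hk' := hN k hk
  rw [Real.dist_0_eq_abs, abs_of_nonneg (integral_nonneg fun x => by positivity)] at hk' ⊢
  -- integrability bookkeeping
  have mE : ∀ k, MemLp (heatExtension (g k) t) 2 volume := fun k =>
    memLp_heatExtension_holds (E := EuclideanSpace ℝ (Fin 3)) (F := EuclideanSpace ℝ (Fin 3)) (hg2 k) one_le_two ht0
  have mEG : MemLp (heatExtension G t) 2 volume :=
    memLp_heatExtension_holds (E := EuclideanSpace ℝ (Fin 3)) (F := EuclideanSpace ℝ (Fin 3)) hG one_le_two ht0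
  have IA : Integrable (fun x => ‖g (φ k) x - heatExtension (g (φ k)) t x‖ ^ 2) :=
    (hM (g (φ k)) (hg1 _) (hI2 _) (hID _) t ht0).1
  have IB : Integrable (fun x => ‖heatExtension (g (φ k)) t x - heatExtension G t x‖ ^ 2) :=
    integrable_norm_sq_of_memLp_two ((mE (φ k)).sub mEG)
  have IC : Integrable (fun x => ‖heatExtension G t x - G x‖ ^ 2) := integrable_norm_sq_of_memLp_two (mEG.sub hG)
  have I0 : Integrable (fun x => ‖g (φ k) x - G x‖ ^ 2) := integrable_norm_sq_of_memLp_two ((hg2 (φ k)).sub hG)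
  -- the mollification estimate for `g_{φ k}`
  have hA : ∫ x, ‖g (φ k) x - heatExtension (g (φ k)) t x‖ ^ 2 ≤ |Cm| * t := by
    refine (hM (g (φ k)) (hg1 _) (hI2 _) (hID _) t ht0).2.trans ?_
    have hD0 : 0 ≤ ∫ x, ‖fderiv ℝ (g (φ k)) x‖ ^ 2 := integral_nonneg fun x => by positivity
    calc Cm * t * ∫ x, ‖fderiv ℝ (g (φ k)) x‖ ^ 2 ≤ |Cm| * t * ∫ x, ‖fderiv ℝ (g (φ k)) x‖ ^ 2 := by
          gcongr; exact le_abs_self Cm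
      _ ≤ |Cm| * t * 1 := by gcongr; exact hD (φ k)
      _ = |Cm| * t := mul_one _
  -- the three-term bound, integrated over the ball
  have IAB : Integrable (fun x => ‖g (φ k) x - heatExtension (g (φ k)) t x‖ ^ 2 +
      ‖heatExtension (g (φ k)) t x - heatExtension G t x‖ ^ 2) := IA.add IB
  have IABC : Integrable (fun x => ‖g (φ k) x - heatExtension (g (φ k)) t x‖ ^ 2 +
      ‖heatExtension (g (φ k)) t x - heatExtension G t x‖ ^ 2 + ‖heatExtension G t x - G x‖ ^ 2) := IAB.add IC
  have I3 : Integrable (fun x => 3 * (‖g (φ k) x - heatExtension (g (φ k)) t x‖ ^ 2 +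
      ‖heatExtension (g (φ k)) t x - heatExtension G t x‖ ^ 2 + ‖heatExtension G t x - G x‖ ^ 2)) := IABC.const_mul 3
  have e1 : (∫ x in Metric.ball (0 : EuclideanSpace ℝ (Fin 3)) R, (‖g (φ k) x - heatExtension (g (φ k)) t x‖ ^ 2 +
      ‖heatExtension (g (φ k)) t x - heatExtension G t x‖ ^ 2 + ‖heatExtension G t x - G x‖ ^ 2)) =
      (∫ x in Metric.ball (0 : EuclideanSpace ℝ (Fin 3)) R, (‖g (φ k) x - heatExtension (g (φ k)) t x‖ ^ 2 +
        ‖heatExtension (g (φ k)) t x - heatExtension G t x‖ ^ 2)) +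
      ∫ x in Metric.ball (0 : EuclideanSpace ℝ (Fin 3)) R, ‖heatExtension G t x - G x‖ ^ 2 :=
    integral_add IAB.integrableOn IC.integrableOn
  have e2 : (∫ x in Metric.ball (0 : EuclideanSpace ℝ (Fin 3)) R, (‖g (φ k) x - heatExtension (g (φ k)) t x‖ ^ 2 +
      ‖heatExtension (g (φ k)) t x - heatExtension G t x‖ ^ 2)) =
      (∫ x in Metric.ball (0 : EuclideanSpace ℝ (Fin 3)) R, ‖g (φ k) x - heatExtension (g (φ k)) t x‖ ^ 2) +
      ∫ x in Metric.ball (0 : EuclideanSpace ℝ (Fin 3)) R, ‖heatExtension (g (φ k)) t x - heatExtension G t x‖ ^ 2 :=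
    integral_add IA.integrableOn IB.integrableOn
  have s1 : ∫ x in Metric.ball (0 : EuclideanSpace ℝ (Fin 3)) R, ‖g (φ k) x - heatExtension (g (φ k)) t x‖ ^ 2 ≤
      ∫ x, ‖g (φ k) x - heatExtension (g (φ k)) t x‖ ^ 2 := setIntegral_le_integral IA (ae_of_all _ fun x => by positivity)
  have s3 : ∫ x in Metric.ball (0 : EuclideanSpace ℝ (Fin 3)) R, ‖heatExtension G t x - G x‖ ^ 2 ≤
      ∫ x, ‖heatExtension G t x - G x‖ ^ 2 := setIntegral_le_integral IC (ae_of_all _ fun x => by positivity)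
  calc ∫ x in Metric.ball (0 : EuclideanSpace ℝ (Fin 3)) R, ‖g (φ k) x - G x‖ ^ 2
      ≤ ∫ x in Metric.ball (0 : EuclideanSpace ℝ (Fin 3)) R, 3 * (‖g (φ k) x - heatExtension (g (φ k)) t x‖ ^ 2 +
          ‖heatExtension (g (φ k)) t x - heatExtension G t x‖ ^ 2 + ‖heatExtension G t x - G x‖ ^ 2) :=
        integral_mono_of_nonneg (ae_of_all _ fun x => by positivity) I3.integrableOn
          (ae_of_all _ fun x => norm_sub_sq_le_three _ _ _ _)
    _ = 3 * ((∫ x in Metric.ball (0 : EuclideanSpace ℝ (Fin 3)) R, ‖g (φ k) x - heatExtension (g (φ k)) t x‖ ^ 2) +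
          (∫ x in Metric.ball (0 : EuclideanSpace ℝ (Fin 3)) R, ‖heatExtension (g (φ k)) t x - heatExtension G t x‖ ^ 2) +
          ∫ x in Metric.ball (0 : EuclideanSpace ℝ (Fin 3)) R, ‖heatExtension G t x - G x‖ ^ 2) := by
        rw [integral_const_mul, e1, e2]
    _ < ε := by linarith [hA, ht2, hk', ht1, s1, s3]

/-- **`NearSaturationNearMaximiser` (stmt-25482) from two heat-semigroup facts and the regularity of the limit profile, BY NAME.**
Hypothesis (R) of `nearSaturationNearMaximiser_of_rellich_of_identification` discharged by `localRellich_of_heat` modulo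
(HM) the mollification estimate and (HC) the `L²`-continuity of `e^{tΔ}` at `0⁺`; (I) as there. [folklore] -/
theorem nearSaturationNearMaximiser_of_heat_of_identification
    (HM : ∃ Cm : ℝ, ∀ g : EuclideanSpace ℝ (Fin 3) → EuclideanSpace ℝ (Fin 3), ContDiff ℝ 1 g →
      Integrable (fun x => ‖g x‖ ^ 2) → Integrable (fun x => ‖fderiv ℝ g x‖ ^ 2) → ∀ t : ℝ, 0 < t →
        Integrable (fun x => ‖g x - heatExtension g t x‖ ^ 2) ∧
          ∫ x, ‖g x - heatExtension g t x‖ ^ 2 ≤ Cm * t * ∫ x, ‖fderiv ℝ g x‖ ^ 2)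
    (HC : ∀ G : EuclideanSpace ℝ (Fin 3) → EuclideanSpace ℝ (Fin 3), MemLp G 2 volume →
      Tendsto (fun t : ℝ => ∫ x, ‖heatExtension G t x - G x‖ ^ 2) (𝓝[>] 0) (𝓝 0))
    (HI : ∀ c : ℝ, (0 < c ∧ (∀ v : EuclideanSpace ℝ (Fin 3) → EuclideanSpace ℝ (Fin 3), (ContDiff ℝ (⊤ : ℕ∞) v ∧
      Literature.Analysis.FluidPDE.VectorCalculus.IsDivFree v ∧ (∫⁻ x, ‖iteratedFDeriv ℝ 0 v x‖ₑ ^ 2 < ⊤) ∧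
      (∫⁻ x, ‖iteratedFDeriv ℝ 1 v x‖ₑ ^ 2 < ⊤) ∧ (∫⁻ x, ‖iteratedFDeriv ℝ 2 v x‖ₑ ^ 2 < ⊤)) → (∫ x,
      ⟪Literature.Analysis.FluidPDE.curl v x, fderiv ℝ v x (Literature.Analysis.FluidPDE.curl v x)⟫_ℝ) ≤ c *
      (∫ x, ‖Literature.Analysis.FluidPDE.curl v x‖ ^ 2) ^ (3 / 4 : ℝ) * (∫ x,
      Literature.Analysis.FluidPDE.frobeniusNormSq (fderiv ℝ (Literature.Analysis.FluidPDE.curl v) x)) ^ (3 / 4 : ℝ)) ∧ ∀ c' : ℝ, (∀ w : EuclideanSpace ℝ (Fin 3) → EuclideanSpace ℝ (Fin 3), (ContDiff ℝ (⊤ : ℕ∞) w ∧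
      Literature.Analysis.FluidPDE.VectorCalculus.IsDivFree w ∧ (∫⁻ x, ‖iteratedFDeriv ℝ 0 w x‖ₑ ^ 2 < ⊤) ∧
      (∫⁻ x, ‖iteratedFDeriv ℝ 1 w x‖ₑ ^ 2 < ⊤) ∧ (∫⁻ x, ‖iteratedFDeriv ℝ 2 w x‖ₑ ^ 2 < ⊤)) → (∫ x,
      ⟪Literature.Analysis.FluidPDE.curl w x, fderiv ℝ w x (Literature.Analysis.FluidPDE.curl w x)⟫_ℝ) ≤ c' *
      (∫ x, ‖Literature.Analysis.FluidPDE.curl w x‖ ^ 2) ^ (3 / 4 : ℝ) * (∫ x,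
      Literature.Analysis.FluidPDE.frobeniusNormSq (fderiv ℝ (Literature.Analysis.FluidPDE.curl w) x)) ^ (3 / 4 : ℝ)) → c ≤ c') →
      ∀ K δ : ℝ, 0 < K → 0 < δ → ∀ v : ℕ → EuclideanSpace ℝ (Fin 3) → EuclideanSpace ℝ (Fin 3),
      (∀ n, (ContDiff ℝ (⊤ : ℕ∞) (v n) ∧
      Literature.Analysis.FluidPDE.VectorCalculus.IsDivFree (v n) ∧ (∫⁻ x, ‖iteratedFDeriv ℝ 0 (v n) x‖ₑ ^ 2 < ⊤) ∧
      (∫⁻ x, ‖iteratedFDeriv ℝ 1 (v n) x‖ₑ ^ 2 < ⊤) ∧ (∫⁻ x, ‖iteratedFDeriv ℝ 2 (v n) x‖ₑ ^ 2 < ⊤))) →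
      (∀ n, (∫ x, ‖Literature.Analysis.FluidPDE.curl (v n) x‖ ^ 2) = 1) →
      (∀ n, (∫ x, Literature.Analysis.FluidPDE.frobeniusNormSq (fderiv ℝ (Literature.Analysis.FluidPDE.curl (v n)) x)) = 1) →
      Tendsto (fun n => ∫ x, ⟪Literature.Analysis.FluidPDE.curl (v n) x, fderiv ℝ (v n) x
        (Literature.Analysis.FluidPDE.curl (v n) x)⟫_ℝ) atTop (𝓝 c) →
      (∀ᶠ n in atTop, δ ≤ ∫ x in Metric.ball (0 : EuclideanSpace ℝ (Fin 3)) K, ‖Literature.Analysis.FluidPDE.curl (v n) x‖ ^ 2) →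
      ∀ (φ₀ : ℕ → ℕ) (M : Fin 3 → EuclideanSpace ℝ (Fin 3) → EuclideanSpace ℝ (Fin 3))
        (Ω : EuclideanSpace ℝ (Fin 3) → EuclideanSpace ℝ (Fin 3)), StrictMono φ₀ →
      (∀ j, MemLp (M j) 2 volume) →
      (∀ (j : Fin 3) (ψ : EuclideanSpace ℝ (Fin 3) → EuclideanSpace ℝ (Fin 3)), MemLp ψ 2 volume →
        Tendsto (fun k => ∫ x, ⟪fderiv ℝ (v (φ₀ k)) x (EuclideanSpace.basisFun (Fin 3) ℝ j), ψ x⟫_ℝ) atTop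
          (𝓝 (∫ x, ⟪M j x, ψ x⟫_ℝ))) →
      MemLp Ω 2 volume →
      (∀ R : ℝ, 0 < R → Tendsto (fun k => ∫ x in Metric.ball (0 : EuclideanSpace ℝ (Fin 3)) R,
          ‖Literature.Analysis.FluidPDE.curl (v (φ₀ k)) x - Ω x‖ ^ 2) atTop (𝓝 0)) →
      ∃ w : EuclideanSpace ℝ (Fin 3) → EuclideanSpace ℝ (Fin 3), (ContDiff ℝ (⊤ : ℕ∞) w ∧
      Literature.Analysis.FluidPDE.VectorCalculus.IsDivFree w ∧ (∫⁻ x, ‖iteratedFDeriv ℝ 0 w x‖ₑ ^ 2 < ⊤) ∧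
      (∫⁻ x, ‖iteratedFDeriv ℝ 1 w x‖ₑ ^ 2 < ⊤) ∧ (∫⁻ x, ‖iteratedFDeriv ℝ 2 w x‖ₑ ^ 2 < ⊤)) ∧
        (∀ j : Fin 3, (fun x => fderiv ℝ w x (EuclideanSpace.basisFun (Fin 3) ℝ j)) =ᵐ[volume] M j) ∧
        Literature.Analysis.FluidPDE.curl w =ᵐ[volume] Ω) :
    Summit.NavierStokesRegularity.NavierStokesRegularity.Theses.EfficiencyFloor.NearSaturationNearMaximiser :=
  nearSaturationNearMaximiser_of_rellich_of_identification (localRellich_of_heat HM HC) HI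

end SeqCore

end NearSaturationNearMaximiser

end Summit.NavierStokesRegularity.NavierStokesRegularity.Theorems

end
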